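import Literature.MathematicalPhysics.QuantumFieldTheory.Balaban1983to89.B11Eq92CommutatorFunctional
import Literature.MathematicalPhysics.QuantumFieldTheory.Balaban1983to89.B11Eq98V0primeCurrentSlots

/-!
# `Balaban1983to89.B11Eq96CommutatorCurrent` — T. Bałaban, *The variational problem and background fields in renormalization group method for lattice gauge theories*, Commun. Math. Phys. **102** (1985) 277–309 [Balaban1985Variational]: (91)–(96) p. 292 with (63) p. 287, (27) p. 282 and (98) p. 293 — THE COMMUTATOR GROUP OF `(δ/δA′)V` AS A CONFIGURATION-VALUED MAP ON THE CARRIERS OF (115): the current `b ↦ Σ_{p∈st(b)} (∂/∂A(b)) ½ i tr((DA)(p)Σ_{b₁≺b₂}[A′(b₁),A′(b₂)])`, typed `Space115 L η lev₀ lev₁ ∇ → NegSize L η lev₀ 3 𝔸`, with its GLOBAL QUADRATIC `|·|_{(−3)}` bound «O(1)|∇A′||A′|» (the leaf `est96` of `B11Prop4Assembly.TermwiseDatum`), its analyticity and the `Prop4Hyp`/`QuadAnalytic` slots (pairing certificate and the whole V₀-group `curV0prime + curComm` in the sequel `B11Eq63V0GroupCurrent`)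

statement-level skeleton of published theorems with citation tags; proofs where landed; nothing here is a claim about the Yang–Mills mass gap

PDF held: `paper:balaban1985-cmp102-variational-background` (journal page = PDF page + 276); pp. 282, 287, 291–293 read from the `lit read` text layer;
displays as transcribed in `B11Eq27Current`, `B11Eq63FunctionalDerivative`, `B11Eq85FirstDerivative`, `B11Eq93Commutator`, `B11Eq115Space`.

CITATION HEADER (lean-in-tree rule 2026-08-18).  WHAT IS REPRODUCED: the last group (91)–(96) of the termwise estimates of `(δ/δA′)V` (row `B11.Eq85`;
`B11Prop4Assembly.TermwiseDatum.W₅`/`est96`/`an₅`), READ AT `A` (no `HD(A′)` insertions), as an OBJECT between the concrete carriers of the pub-balaban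
NE9 letter map (letter (L3) `W = (δ/δA′)V`; W-slot of `B11Eq115Space.chartHB115` / `B11Eq103H1Complex.chartOfLetters`) — the companion of the
V′₀-current `B11Eq90V0primeCurrent.curV0prime`; together they are «W for the V₀ term of (80)».  THE PRINT (p. 292): *«… the functional derivatives
connected with the second and third terms are estimated easily by O(1)|DA′||A′|. We transform the first term integrating by parts, and we get the
functional derivative given by ½D*Σi[A″, A″]. (93) … Thus these terms in (93) can be estimated by O(1)|∇A′||A′|. … From this it follows that the
expression (95) can be estimated by O(1)|∇A′||A′| also.»*; p. 293 (98): *«|((δ/δA′)V)(A′)|₍₋₃₎ ≦ C₄(max{|A′|₍₋₁₎, |∇A′|₍₋₂₎})²»*.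

THE DICTIONARY.  As `B11Eq90V0primeCurrent` (torus bridge `Tsh`/`Ucur`/`curL`, dualising map `ρ` of the bilinear pairing (27)); in addition
**`nab_curL_eq`**: r08's unit-lattice derivative `nab` (`B11Eq94CommutatorBond`) IS `η·nabla115` — so print's `|∇A′|` enters through the SECOND half
`|∇·|₍₋₂₎` of the (115) norm (`JetSup.norm_snd_le`), at `∇ = nabla115 η U₀`; this is the first brick of the (L3) line that uses it.

WHAT IS DEFINED AND PROVED (sorry-free; axioms `propext` / `Classical.choice` / `Quot.sound`; no `Prop`-valued definition, no new named fact).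
§4 `nab_curL_eq`; **`curComm ρ τ U₀ : Space115 L η lev₀ lev₁ Dc → NegSize L η lev₀ 3 𝔸`** (`curComm_apply`), for any `Dc`;
   **`differentiable_curComm`** (Fréchet, everywhere — the `an₅` clause); `exists_of_mem_st` (the shape of the plaquettes of `st(b)`).
§5 AT `Dc := nabla115 η U₀`: **`norm_curComm_le`** — `‖curComm(Y)‖₍₋₃₎ ≦ (d − 1)Λ³(136 + 2Λ)‖ρ‖‖τ‖·‖Y‖²` FOR EVERY `Y` (no smallness: the group is
   polynomial), from `B11Eq92CommutatorFunctional.opNorm_sum_dTerm39Bond_le` + `B11Eq94CommutatorBond.norm_divP_comm2F_le` with the majorants read off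
   the weights: letters `≦ Λ(Lʲ⁽ᵇ⁾η)⁻¹‖Y‖`, `|∇¹| ≦ ηΛ²(Lʲ⁽ᵇ⁾η)⁻²‖Y‖`, `|(D^ηA)(p)| ≦ 2Λ²(Lʲ⁽ᵇ⁾η)⁻²‖Y‖`; **`est96_curComm`** (`TermwiseDatum.est96` shape
   `≦ K₅ε₃²`); **`prop4Hyp_curComm`**, **`quadAnalytic_curComm`** (any radius).
(§6–§7 — the pairing certificate `⟨curComm(Y), δ⟩ = (d/dt) Σ_p η^d term39(Y + tδ, ∂p)|₀` and the V₀-GROUP current `curV0 := curV0prime + curComm`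
with `⟨curV0(Y), δ⟩ = (d/dt)V₀(Y + tδ)|₀` for the WHOLE remainder `V₀` of (26) — are the sequel `B11Eq63V0GroupCurrent`, kept apart for the 400-line rule.)

HYPOTHESES OF §5 (print's, displayed): unit-ball transports; tracial `τ`; `1 ≦ L`; the LEVEL-GEOMETRY letter `Λ ≧ 1` in three displays — `hΛ` (as in
`B11Eq90V0primeCurrent`: `Lʲ⁽ᵇ⁾η ≦ Λ·w(q)` for `q ∈ st(b)`), `hΛa` (the (−1)-weights on the plaquette star of `b`: `Lʲ⁽ᵇ⁾η ≦ Λ·Lʲ⁽ᵇ′⁾η` for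
`b′ = (y, μ), (y, ν)`, `y ∈ {x, x − e_ν}`), `hΛ'` (the (−2)-weights there: `(Lʲ⁽ᵇ⁾η)² ≦ Λ²·(Lʲ⁽ᵖ⁾η)²`) — all three follow from «neighbouring points differ
by at most one level» (the domain-sequence conditions of [6] Sect. A invoked on p. 278 via (2)) with `Λ = L²`.

HONEST SCOPE — what is NOT claimed.  (i) The commutator-group current AT `A` for the term of (39)/(91) WITHOUT `HD(A′)` insertions («the other terms …
obtained by replacing some A′ in the commutator by −HD(A′)» need Sect. C's `H`, `D`); no composition with (47); so `curV0` is «W for the V₀ term of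
(80)» read at `A`, NOT (L3) `W` (the groups (85)–(89) remain).  (ii) `ρ`, `Λ` letters (ρ constructed in `B11Eq98V0primeCurrentSlots` §7).  (iii)
DIVERGENCE D-pv27.4 inherited.  (iv) Constants `136`, `2`, `1024`, … are witnesses of print's O(1).  (v) NOT summit progress (cell pub-balaban: NE9
NOT PRINTED / NOT PROVED; spine PROVED 0/9).  Unit `b2b-balaban-t4-ne9-formalise-leaf-05` (NE9 crux-team leaf prover, gen 64).  Imports
`B11Eq92CommutatorFunctional` and `B11Eq98V0primeCurrentSlots` (this lineage) ONLY; modifies nothing of r08's or of the owner's.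
-/

noncomputable section

open NormedSpace Complex Metric Set Finset Filter Topology

namespace Literature.MathematicalPhysics.QuantumFieldTheory.Balaban1983to89.B11Eq96CommutatorCurrent

open Literature.MathematicalPhysics.QuantumFieldTheory.Balaban1983to89.Beta.TransportVertices
open Literature.MathematicalPhysics.QuantumFieldTheory.Balaban1983to89.B9Eq37Insertion
open Literature.MathematicalPhysics.QuantumFieldTheory.Balaban1983to89.B9Eq39Adjoint
open Literature.MathematicalPhysics.QuantumFieldTheory.Balaban1983to89.B11Eq26ActionExpansion
open Literature.MathematicalPhysics.QuantumFieldTheory.Balaban1983to89.B11Eq90V0Derivative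
open Literature.MathematicalPhysics.QuantumFieldTheory.Balaban1983to89.B11Eq90StB
open Literature.MathematicalPhysics.QuantumFieldTheory.Balaban1983to89.B11Eq90V0primeBond
open Literature.MathematicalPhysics.QuantumFieldTheory.Balaban1983to89.B11Eq94CommutatorBond
open Literature.MathematicalPhysics.QuantumFieldTheory.Balaban1983to89.B11Eq92CommutatorFunctional
open Literature.MathematicalPhysics.QuantumFieldTheory.Balaban1983to89.B11Eq90V0primeCurrent
open Literature.MathematicalPhysics.QuantumFieldTheory.Balaban1983to89.B11Eq98V0primeCurrentSlots
open B9SectCLatticeCarrier (Bond) open B4Sect5Torus (TSite) open B9Eq33CovDerivVector (shiftEquiv)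
open B11Eq115Space
open B11Eq111FrakG (nabla115 nabla115_apply)

variable {𝔸 : Type*} [NormedRing 𝔸] [NormedAlgebra ℂ 𝔸] [CompleteSpace 𝔸]

/-! ## §4 The commutator-group current on the carriers -/

section Carrier

variable {d : ℕ} {Pd : Fin d → ℕ}

omit [CompleteSpace 𝔸] in
/-- **The unit-lattice derivative under the bridge IS `η·∇`**: `nab Tsh (Ucur U₀) (curL f) μ ν x = η • (nabla115 η U₀ f)((x, μ), ν)`.
[cite: Balaban1985BackgroundPropagators, (3.3) p.391] -/
theorem nab_curL_eq {η : ℝ} (hη : η ≠ 0) (U₀ : Bond d Pd → 𝔸ˣ) (f : Bond d Pd → 𝔸) (μ ν : Fin d) (x : TSite d Pd) :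
    nab Tsh (Ucur U₀) (curL f) μ ν x = (η : ℂ) • nabla115 η U₀ f ((x, μ), ν) := by
  rw [nabla115_apply, smul_smul, mul_inv_cancel₀ (by exact_mod_cast hη), one_smul]
  simp only [nab, R_def, Ucur, curL_apply]
  rfl

/-- The shape of a plaquette of `st(b)`, `b = (x₀, μ₀)`: its base site is `x₀` or `T_ν⁻¹x₀` and its directions are `{μ₀, ν}` for some `ν`.
[cite: Balaban1985Variational, (90) p.291] -/
theorem exists_of_mem_st {S : Type*} [Fintype S] [DecidableEq S] {ι : Type*} [Fintype ι] [LinearOrder ι] (T : ι → Equiv.Perm S)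
    {μ₀ : ι} {x₀ : S} {q : S × ι × ι} (hq : q ∈ st T μ₀ x₀) :
    ∃ ν : ι, (q.1 = x₀ ∨ q.1 = (T ν).symm x₀) ∧ ((q.2.1 = μ₀ ∧ q.2.2 = ν) ∨ (q.2.1 = ν ∧ q.2.2 = μ₀)) := by
  rw [st, Finset.mem_filter] at hq
  obtain ⟨-, h⟩ := hq
  rcases h with ⟨hμ, hx | hx⟩ | ⟨hν, hx | hx⟩
  · exact ⟨q.2.2, Or.inr (by rw [← hx, Equiv.symm_apply_apply]), Or.inl ⟨hμ, rfl⟩⟩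
  · exact ⟨q.2.2, Or.inl hx, Or.inl ⟨hμ, rfl⟩⟩
  · exact ⟨q.2.1, Or.inl hx, Or.inr ⟨rfl, hν⟩⟩
  · exact ⟨q.2.1, Or.inr (by rw [← hx, Equiv.symm_apply_apply]), Or.inr ⟨rfl, hν⟩⟩

variable {L η : ℝ} [Fact (0 < L)] [Fact (0 < η)] {lev₀ : Bond d Pd → ℕ} {κ' : Type*} [Fintype κ'] {lev₁ : κ' → ℕ}
  {Dc : (Bond d Pd → 𝔸) →ₗ[ℂ] (κ' → 𝔸)}

/-- **THE COMMUTATOR-GROUP CURRENT ON THE CARRIERS OF (115)**: `curComm(Y)(b) = Σ_{p∈st(b)} ρ((∂/∂A(b)) ½ i tr((DA)(p)Σ[A′,A′](p)))` at `A = curL Y`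
— the functional derivative of the (39)-part `Σ_p η^d·term39(A, ∂p)` of `V₀` ((91)), represented bond by bond through the dualising map `ρ` of (27);
defined for any derivative letter `Dc` (estimated at `Dc := nabla115 η U₀`). [cite: Balaban1985Variational, (91)–(93) p.292, (63) p.287] -/
def curComm (ρ : (𝔸 →L[ℂ] ℂ) →L[ℂ] 𝔸) (τ : 𝔸 →L[ℂ] ℂ) (U₀ : Bond d Pd → 𝔸ˣ)
    (Y : Space115 L η lev₀ lev₁ Dc) : NegSize L η lev₀ 3 𝔸 :=
  (NegSup.equiv (levWeight L η lev₀ 3) 𝔸).symm fun b =>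
    ∑ q ∈ st Tsh b.2 b.1, ρ (dTerm39Bond Tsh (Ucur U₀) η τ
      (curL (JetSup.equiv (levWeight L η lev₀ 1) (levWeight L η lev₁ 2) Dc Y)) q b.2 b.1)

omit [CompleteSpace 𝔸] [Fact (0 < L)] [Fact (0 < η)] [Fintype κ'] in
/-- Unfolding the current at a bond. [cite: Balaban1985Variational, (93) p.292] -/
theorem curComm_apply (ρ : (𝔸 →L[ℂ] ℂ) →L[ℂ] 𝔸) (τ : 𝔸 →L[ℂ] ℂ) (U₀ : Bond d Pd → 𝔸ˣ)
    (Y : Space115 L η lev₀ lev₁ Dc) (b : Bond d Pd) :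
    NegSup.equiv (levWeight L η lev₀ 3) 𝔸 (curComm (lev₁ := lev₁) (Dc := Dc) ρ τ U₀ Y) b
      = ∑ q ∈ st Tsh b.2 b.1, ρ (dTerm39Bond Tsh (Ucur U₀) η τ
          (curL (JetSup.equiv (levWeight L η lev₀ 1) (levWeight L η lev₁ 2) Dc Y)) q b.2 b.1) := rfl

omit [CompleteSpace 𝔸] in
/-- **The commutator-group current is an entire function of the configuration** (Fréchet, everywhere — the `an₅` clause of
`B11Prop4Assembly.TermwiseDatum`). [cite: Balaban1985Variational, Prop. 4 p.292] -/
theorem differentiable_curComm (ρ : (𝔸 →L[ℂ] ℂ) →L[ℂ] 𝔸) (τ : 𝔸 →L[ℂ] ℂ) (U₀ : Bond d Pd → 𝔸ˣ) :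
    Differentiable ℂ (curComm (L := L) (η := η) (lev₀ := lev₀) (lev₁ := lev₁) (Dc := Dc) ρ τ U₀) := by
  show Differentiable ℂ (fun Y => (NegSup.continuousLinearEquiv ℂ (levWeight L η lev₀ 3)).symm (fun b =>
    ∑ q ∈ st Tsh b.2 b.1, ρ (dTerm39Bond Tsh (Ucur U₀) η τ (curL (flat115 Y)) q b.2 b.1)))
  refine (ContinuousLinearEquiv.differentiable _).comp (differentiable_pi.2 fun b => ?_)
  refine Differentiable.fun_sum fun q _ => ρ.differentiable.comp ?_
  exact differentiable_dTerm39Bond_comp Tsh (Ucur U₀)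
    ((curL : (Bond d Pd → 𝔸) →L[ℂ] (Fin d → TSite d Pd → 𝔸)).comp
      (flat115 (L := L) (η := η) (lev₀ := lev₀) (lev₁ := lev₁) (Dc := Dc))) η τ q b.2 b.1

end Carrier

/-! ## §5 The `|·|_{(−3)}` bound at `∇ = nabla115 η U₀`: «O(1)|∇A′||A′|» -/

section Bound

variable {d : ℕ} {Pd : Fin d → ℕ} {L η : ℝ} [Fact (0 < L)] [Fact (0 < η)] {lev₀ : Bond d Pd → ℕ}
  {lev₁ : Bond d Pd × Fin d → ℕ} [NormOneClass 𝔸]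

omit [CompleteSpace 𝔸] in
/-- **THE `|·|_{(−3)}` BOUND OF THE COMMUTATOR-GROUP CURRENT** — «estimated by O(1)|∇A′||A′|»: for EVERY configuration `Y` of the space (115) at
`∇ = nabla115 η U₀`, `‖curComm(Y)‖₍₋₃₎ ≦ (d − 1)Λ³(136 + 2Λ)‖ρ‖‖τ‖·‖Y‖²` (global, quadratic), under unit-ball transports, a tracial `τ`, `1 ≦ L` and
the level-geometry letters `hΛ`, `hΛa`, `hΛ'` (header).  Assembly: `opNorm_sum_dTerm39Bond_le` with `D ≦ (d − 1)(16an + 4n²)` (`norm_divP_comm2F_le`),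
`a = Λ‖Y‖/w(b)`, `n = ηΛ²‖Y‖/w(b)²`, `s = 4a`, `G₂ = 2Λ²‖Y‖/w(b)²`, then `w(b)³ × (…)` and `η ≦ w(b)`. [cite: Balaban1985Variational, (93)–(96) p.292, (98) p.293] -/
theorem norm_curComm_le (ρ : (𝔸 →L[ℂ] ℂ) →L[ℂ] 𝔸) (τ : 𝔸 →L[ℂ] ℂ) (U₀ : Bond d Pd → 𝔸ˣ)
    (hUn : ∀ b, ‖(U₀ b : 𝔸)‖ ≤ 1 ∧ ‖(((U₀ b)⁻¹ : 𝔸ˣ) : 𝔸)‖ ≤ 1)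
    (hτ : ∀ a b : 𝔸, τ (a * b) = τ (b * a)) (hL : 1 ≤ L) {Λ : ℝ} (hΛ1 : 1 ≤ Λ)
    (hΛ : ∀ q ∈ posPlaq (TSite d Pd) (Fin d), ∀ (μ₀ : Fin d) (x₀ : TSite d Pd), q ∈ st Tsh μ₀ x₀ →
      levWeight L η lev₀ 1 (x₀, μ₀) ≤ Λ * plaqWeight Tsh (levWeight L η lev₀ 1) q)
    (hΛa : ∀ (x₀ : TSite d Pd) (μ₀ ν : Fin d) (y : TSite d Pd), (y = x₀ ∨ y = (Tsh ν).symm x₀) →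
      levWeight L η lev₀ 1 (x₀, μ₀) ≤ Λ * levWeight L η lev₀ 1 (y, μ₀) ∧
        levWeight L η lev₀ 1 (x₀, μ₀) ≤ Λ * levWeight L η lev₀ 1 (y, ν))
    (hΛ' : ∀ (x₀ : TSite d Pd) (μ₀ ν : Fin d) (y : TSite d Pd), (y = x₀ ∨ y = (Tsh ν).symm x₀) →
      ∀ κ κ'' : Fin d, (κ = μ₀ ∨ κ = ν) → (κ'' = μ₀ ∨ κ'' = ν) →
        levWeight L η lev₀ 1 (x₀, μ₀) ^ 2 ≤ Λ ^ 2 * levWeight L η lev₁ 2 ((y, κ), κ''))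
    (Y : Space115 L η lev₀ lev₁ (nabla115 η U₀)) :
    ‖curComm (lev₁ := lev₁) (Dc := nabla115 η U₀) ρ τ U₀ Y‖
      ≤ ((d - 1 : ℕ) : ℝ) * Λ ^ 3 * (136 + 2 * Λ) * ‖ρ‖ * ‖τ‖ * ‖Y‖ ^ 2 := by
  have hη : 0 < η := Fact.out
  have hΛ0 : 0 < Λ := lt_of_lt_of_le one_pos hΛ1
  set w : Bond d Pd → ℝ := levWeight L η lev₀ 1 with hw
  set w₁ : Bond d Pd × Fin d → ℝ := levWeight L η lev₁ 2 with hw₁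
  have hw0 : ∀ b, 0 < w b := levWeight_pos (Fact.out) hη lev₀ 1
  have hw₁0 : ∀ p, 0 < w₁ p := levWeight_pos (Fact.out) hη lev₁ 2
  set N := ‖Y‖ with hN
  refine (NegSup.norm_le_iff (by positivity)).2 fun b => ?_
  obtain ⟨x₀, μ₀⟩ := b
  have hwb : 0 < w (x₀, μ₀) := hw0 _
  have hηw : η ≤ w (x₀, μ₀) := eta_le_levWeight_one (lev₀ := lev₀) hL _
  rw [curComm_apply]
  have hw3 : levWeight L η lev₀ 3 (x₀, μ₀) = w (x₀, μ₀) ^ 3 := by simp [hw, levWeight_apply]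
  rw [hw3]
  set A := curL (JetSup.equiv (levWeight L η lev₀ 1) (levWeight L η lev₁ 2) (nabla115 η U₀) Y) with hA
  -- the case `Y = 0`
  by_cases hY : Y = 0
  · have hA0 : A = 0 := by simp [hA, hY]
    simp only [hA0, dTerm39Bond_zero, map_zero, Finset.sum_const_zero, norm_zero, mul_zero]
    positivity
  have hN0 : 0 < N := norm_pos_iff.2 hY
  -- pointwise readings of the (115) norm
  have hA1 : ∀ (κ : Fin d) (y : TSite d Pd), ‖A κ y‖ ≤ (w (y, κ))⁻¹ * N := fun κ y => by
    have := NegSup.norm_apply_le (JetSup.fst Y) (y, κ)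
    exact this.trans (mul_le_mul_of_nonneg_left (JetSup.norm_fst_le Y) (inv_nonneg.2 (hw0 _).le))
  have hA2 : ∀ p : Bond d Pd × Fin d, ‖nabla115 η U₀
      (JetSup.equiv (levWeight L η lev₀ 1) (levWeight L η lev₁ 2) (nabla115 η U₀) Y) p‖ ≤ (w₁ p)⁻¹ * N := fun p => by
    have := NegSup.norm_apply_le (JetSup.snd Y) p
    exact this.trans (mul_le_mul_of_nonneg_left (JetSup.norm_snd_le Y) (inv_nonneg.2 (hw₁0 _).le))
  -- the majorants at the bond `b`
  set a : ℝ := Λ * (w (x₀, μ₀))⁻¹ * N with ha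
  set n : ℝ := η * (Λ ^ 2 * ((w (x₀, μ₀)) ^ 2)⁻¹ * N) with hn
  have ha0 : 0 ≤ a := by positivity
  have hn0 : 0 ≤ n := by positivity
  -- letters on comparable bonds
  have hletter : ∀ (κ : Fin d) (y : TSite d Pd), w (x₀, μ₀) ≤ Λ * w (y, κ) → ‖A κ y‖ ≤ a := by
    intro κ y hcmp
    refine (hA1 κ y).trans ?_
    rw [ha]
    refine mul_le_mul_of_nonneg_right ?_ (norm_nonneg _)
    rw [le_mul_inv_iff₀ hwb, inv_mul_le_iff₀ (hw0 _), mul_comm]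
    exact hcmp
  -- derivative letters `∇¹ = η∇` on comparable points
  have hder : ∀ (ν : Fin d) (y : TSite d Pd), (y = x₀ ∨ y = (Tsh ν).symm x₀) → ∀ κ κ'' : Fin d,
      (κ = μ₀ ∨ κ = ν) → (κ'' = μ₀ ∨ κ'' = ν) →
      ‖nabla115 η U₀ (JetSup.equiv (levWeight L η lev₀ 1) (levWeight L η lev₁ 2) (nabla115 η U₀) Y) ((y, κ), κ'')‖
        ≤ Λ ^ 2 * ((w (x₀, μ₀)) ^ 2)⁻¹ * N := by
    intro ν y hy κ κ'' hκ hκ''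
    refine (hA2 _).trans (mul_le_mul_of_nonneg_right ?_ (norm_nonneg _))
    rw [le_mul_inv_iff₀ (pow_pos hwb 2), inv_mul_le_iff₀ (hw₁0 _), mul_comm]
    exact hΛ' x₀ μ₀ ν y hy κ κ'' hκ hκ''
  have hnab : ∀ (ν : Fin d) (y : TSite d Pd), (y = x₀ ∨ y = (Tsh ν).symm x₀) → ∀ κ κ'' : Fin d,
      (κ = μ₀ ∨ κ = ν) → (κ'' = μ₀ ∨ κ'' = ν) → ‖nab Tsh (Ucur U₀) A κ κ'' y‖ ≤ n := by
    intro ν y hy κ κ'' hκ hκ''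
    rw [hA, nab_curL_eq hη.ne' U₀, norm_smul, Complex.norm_real, Real.norm_of_nonneg hη.le, hn]
    exact mul_le_mul_of_nonneg_left (hder ν y hy κ κ'' hκ hκ'') hη.le
  -- the curl on the plaquettes of `st(b)`
  set G₂ : ℝ := 2 * (Λ ^ 2 * ((w (x₀, μ₀)) ^ 2)⁻¹ * N) with hG₂
  have hG0 : 0 ≤ G₂ := by positivity
  have hcurl : ∀ q ∈ st Tsh μ₀ x₀, ‖curlη Tsh (Ucur U₀) η A q.2.1 q.2.2 q.1‖ ≤ G₂ := by
    intro q hq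
    obtain ⟨ν, hy, hdir⟩ := exists_of_mem_st Tsh hq
    have hκ1 : q.2.1 = μ₀ ∨ q.2.1 = ν := hdir.elim (fun h => Or.inl h.1) (fun h => Or.inr h.1)
    have hκ2 : q.2.2 = μ₀ ∨ q.2.2 = ν := hdir.elim (fun h => Or.inr h.2) (fun h => Or.inl h.2)
    rw [hA, curlη_curL_eq_nabla115]
    calc _ ≤ _ := norm_sub_le _ _
      _ ≤ Λ ^ 2 * ((w (x₀, μ₀)) ^ 2)⁻¹ * N + Λ ^ 2 * ((w (x₀, μ₀)) ^ 2)⁻¹ * N :=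
          add_le_add (hder ν q.1 hy q.2.1 q.2.2 hκ1 hκ2) (hder ν q.1 hy q.2.2 q.2.1 hκ2 hκ1)
      _ = G₂ := by rw [hG₂]; ring
  -- the letters of the plaquettes of `st(b)`
  have hs : ∀ q ∈ st Tsh μ₀ x₀, size (lettersA Tsh (Ucur U₀) A q.2.1 q.2.2 q.1) ≤ 4 * a := by
    intro q hq
    have hqP : q ∈ posPlaq (TSite d Pd) (Fin d) := st_subset_posPlaq Tsh μ₀ x₀ hq
    have hpw := hΛ q hqP μ₀ x₀ hq
    have hc : ∀ b' : Bond d Pd, plaqWeight Tsh w q ≤ w b' → w (x₀, μ₀) ≤ Λ * w b' := fun b' hb' =>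
      hpw.trans (mul_le_mul_of_nonneg_left hb' hΛ0.le)
    rw [size_lettersA]
    have h1 := (norm_R_le (hUn (q.1, q.2.2)).1 (hUn (q.1, q.2.2)).2 (A q.2.1 (Tsh q.2.2 q.1))).trans
      (hletter q.2.1 (Tsh q.2.2 q.1) (hc _ (plaqWeight_le₃ Tsh w q)))
    have h2 := hletter q.2.2 q.1 (hc _ (plaqWeight_le₄ Tsh w q))
    have h3 := hletter q.2.1 q.1 (hc _ (plaqWeight_le₁ Tsh w q))
    have h4 := (norm_R_le (hUn (q.1, q.2.1)).1 (hUn (q.1, q.2.1)).2 (A q.2.2 (Tsh q.2.1 q.1))).trans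
      (hletter q.2.2 (Tsh q.2.1 q.1) (hc _ (plaqWeight_le₂ Tsh w q)))
    simp only [Ucur] at h1 h4 ⊢
    linarith
  -- the `D*` of the commutator field at `b`
  have hDbd := norm_divP_comm2F_le Tsh (Ucur U₀) (fun μ x => hUn (x, μ)) A μ₀ x₀ ha0 hn0
    (fun ν y hy => ⟨hletter μ₀ y (hΛa x₀ μ₀ ν y hy).1, hletter ν y (hΛa x₀ μ₀ ν y hy).2⟩) hnab
  rw [Fintype.card_fin] at hDbd
  set D : ℝ := ((d - 1 : ℕ) : ℝ) * (16 * a * n + 4 * n ^ 2) with hD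
  have hD0 : 0 ≤ D := by positivity
  -- the operator norm of the summed functional
  have hop := opNorm_sum_dTerm39Bond_le Tsh (Ucur U₀) (fun μ x => hUn (x, μ)) τ hτ hη A μ₀ x₀ (s := 4 * a)
    (by positivity) hD0 hG0 hs hcurl hDbd
  rw [Fintype.card_fin] at hop
  -- assemble
  rw [← map_sum]
  have hρ := (ρ.le_opNorm (∑ q ∈ st Tsh μ₀ x₀, dTerm39Bond Tsh (Ucur U₀) η τ A q μ₀ x₀)).trans
    (mul_le_mul_of_nonneg_left hop (norm_nonneg ρ))
  have hηw' : η * (w (x₀, μ₀))⁻¹ ≤ 1 := by rw [mul_inv_le_iff₀ hwb, one_mul]; exact hηw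
  have key : w (x₀, μ₀) ^ 3 * (‖ρ‖ * (‖τ‖ * (2⁻¹ * η⁻¹ * D + 16 * ((d - 1 : ℕ) : ℝ) * G₂ * (4 * a))))
      = ((d - 1 : ℕ) : ℝ) * ‖ρ‖ * ‖τ‖ * N ^ 2 * (136 * Λ ^ 3 + 2 * Λ ^ 4 * (η * (w (x₀, μ₀))⁻¹)) := by
    rw [hD, hG₂, ha, hn]
    field_simp
    ring
  calc w (x₀, μ₀) ^ 3 * ‖ρ (∑ q ∈ st Tsh μ₀ x₀, dTerm39Bond Tsh (Ucur U₀) η τ A q μ₀ x₀)‖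
      ≤ w (x₀, μ₀) ^ 3 * (‖ρ‖ * (‖τ‖ * (2⁻¹ * η⁻¹ * D + 16 * ((d - 1 : ℕ) : ℝ) * G₂ * (4 * a)))) :=
        mul_le_mul_of_nonneg_left hρ (by positivity)
    _ = ((d - 1 : ℕ) : ℝ) * ‖ρ‖ * ‖τ‖ * N ^ 2 * (136 * Λ ^ 3 + 2 * Λ ^ 4 * (η * (w (x₀, μ₀))⁻¹)) := key
    _ ≤ ((d - 1 : ℕ) : ℝ) * ‖ρ‖ * ‖τ‖ * N ^ 2 * (136 * Λ ^ 3 + 2 * Λ ^ 4 * 1) := by gcongr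
    _ = ((d - 1 : ℕ) : ℝ) * Λ ^ 3 * (136 + 2 * Λ) * ‖ρ‖ * ‖τ‖ * ‖Y‖ ^ 2 := by rw [hN]; ring

omit [CompleteSpace 𝔸] in
/-- **THE LEAF `est96` OF `B11Prop4Assembly.TermwiseDatum`** («(91)–(96) … ≦ K₅ε₃² under (77)»): for `0 < ε₃ ≦ a` and `‖Y‖ < ε₃`,
`‖curComm(Y)‖₍₋₃₎ ≦ K₅ε₃²` with `K₅ = (d − 1)Λ³(136 + 2Λ)‖ρ‖‖τ‖` (any `a`). [cite: Balaban1985Variational, (96) p.292, (97) p.293] -/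
theorem est96_curComm (ρ : (𝔸 →L[ℂ] ℂ) →L[ℂ] 𝔸) (τ : 𝔸 →L[ℂ] ℂ) (U₀ : Bond d Pd → 𝔸ˣ)
    (hUn : ∀ b, ‖(U₀ b : 𝔸)‖ ≤ 1 ∧ ‖(((U₀ b)⁻¹ : 𝔸ˣ) : 𝔸)‖ ≤ 1)
    (hτ : ∀ a b : 𝔸, τ (a * b) = τ (b * a)) (hL : 1 ≤ L) {Λ : ℝ} (hΛ1 : 1 ≤ Λ)
    (hΛ : ∀ q ∈ posPlaq (TSite d Pd) (Fin d), ∀ (μ₀ : Fin d) (x₀ : TSite d Pd), q ∈ st Tsh μ₀ x₀ →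
      levWeight L η lev₀ 1 (x₀, μ₀) ≤ Λ * plaqWeight Tsh (levWeight L η lev₀ 1) q)
    (hΛa : ∀ (x₀ : TSite d Pd) (μ₀ ν : Fin d) (y : TSite d Pd), (y = x₀ ∨ y = (Tsh ν).symm x₀) →
      levWeight L η lev₀ 1 (x₀, μ₀) ≤ Λ * levWeight L η lev₀ 1 (y, μ₀) ∧
        levWeight L η lev₀ 1 (x₀, μ₀) ≤ Λ * levWeight L η lev₀ 1 (y, ν))
    (hΛ' : ∀ (x₀ : TSite d Pd) (μ₀ ν : Fin d) (y : TSite d Pd), (y = x₀ ∨ y = (Tsh ν).symm x₀) →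
      ∀ κ κ'' : Fin d, (κ = μ₀ ∨ κ = ν) → (κ'' = μ₀ ∨ κ'' = ν) →
        levWeight L η lev₀ 1 (x₀, μ₀) ^ 2 ≤ Λ ^ 2 * levWeight L η lev₁ 2 ((y, κ), κ'')) (a : ℝ) :
    ∀ (ε₃ : ℝ) (Y : Space115 L η lev₀ lev₁ (nabla115 η U₀)), 0 < ε₃ → ε₃ ≤ a → ‖Y‖ < ε₃ →
      ‖curComm (lev₁ := lev₁) (Dc := nabla115 η U₀) ρ τ U₀ Y‖
        ≤ (((d - 1 : ℕ) : ℝ) * Λ ^ 3 * (136 + 2 * Λ) * ‖ρ‖ * ‖τ‖) * ε₃ ^ 2 := by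
  intro ε₃ Y _ _ hY
  have h := norm_curComm_le (lev₁ := lev₁) ρ τ U₀ hUn hτ hL hΛ1 hΛ hΛa hΛ' Y
  have hC : 0 ≤ ((d - 1 : ℕ) : ℝ) * Λ ^ 3 * (136 + 2 * Λ) * ‖ρ‖ * ‖τ‖ := by
    have : 0 ≤ Λ := zero_le_one.trans hΛ1
    positivity
  have hsq : ‖Y‖ ^ 2 ≤ ε₃ ^ 2 := pow_le_pow_left₀ (norm_nonneg _) hY.le 2
  exact h.trans (mul_le_mul_of_nonneg_left hsq hC)

omit [CompleteSpace 𝔸] in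
/-- **THE `Prop4Hyp` SLOT FOR THE COMMUTATOR-GROUP CURRENT** (any radius `a₃`): the quadratic bound and Fréchet differentiability.
[cite: Balaban1985Variational, Prop. 4 (97)-(98) pp.292-293] -/
theorem prop4Hyp_curComm (ρ : (𝔸 →L[ℂ] ℂ) →L[ℂ] 𝔸) (τ : 𝔸 →L[ℂ] ℂ) (U₀ : Bond d Pd → 𝔸ˣ)
    (hUn : ∀ b, ‖(U₀ b : 𝔸)‖ ≤ 1 ∧ ‖(((U₀ b)⁻¹ : 𝔸ˣ) : 𝔸)‖ ≤ 1)
    (hτ : ∀ a b : 𝔸, τ (a * b) = τ (b * a)) (hL : 1 ≤ L) {Λ : ℝ} (hΛ1 : 1 ≤ Λ)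
    (hΛ : ∀ q ∈ posPlaq (TSite d Pd) (Fin d), ∀ (μ₀ : Fin d) (x₀ : TSite d Pd), q ∈ st Tsh μ₀ x₀ →
      levWeight L η lev₀ 1 (x₀, μ₀) ≤ Λ * plaqWeight Tsh (levWeight L η lev₀ 1) q)
    (hΛa : ∀ (x₀ : TSite d Pd) (μ₀ ν : Fin d) (y : TSite d Pd), (y = x₀ ∨ y = (Tsh ν).symm x₀) →
      levWeight L η lev₀ 1 (x₀, μ₀) ≤ Λ * levWeight L η lev₀ 1 (y, μ₀) ∧
        levWeight L η lev₀ 1 (x₀, μ₀) ≤ Λ * levWeight L η lev₀ 1 (y, ν))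
    (hΛ' : ∀ (x₀ : TSite d Pd) (μ₀ ν : Fin d) (y : TSite d Pd), (y = x₀ ∨ y = (Tsh ν).symm x₀) →
      ∀ κ κ'' : Fin d, (κ = μ₀ ∨ κ = ν) → (κ'' = μ₀ ∨ κ'' = ν) →
        levWeight L η lev₀ 1 (x₀, μ₀) ^ 2 ≤ Λ ^ 2 * levWeight L η lev₁ 2 ((y, κ), κ'')) (a₃ : ℝ) :
    B11Prop6Scheme.Prop4Hyp (curComm (L := L) (η := η) (lev₀ := lev₀) (lev₁ := lev₁) (Dc := nabla115 η U₀) ρ τ U₀)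
      (((d - 1 : ℕ) : ℝ) * Λ ^ 3 * (136 + 2 * Λ) * ‖ρ‖ * ‖τ‖) a₃ where
  quad Y _ := norm_curComm_le (lev₁ := lev₁) ρ τ U₀ hUn hτ hL hΛ1 hΛ hΛa hΛ' Y
  differentiableOn := (differentiable_curComm (lev₁ := lev₁) (Dc := nabla115 η U₀) ρ τ U₀).differentiableOn

omit [CompleteSpace 𝔸] in
/-- **THE `Regime.quad` SLOT FOR THE COMMUTATOR GROUP**: `QuadAnalytic (curComm ρ τ U₀) ((d − 1)Λ³(136 + 2Λ)‖ρ‖‖τ‖) a₃` for any radius.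
[cite: Balaban1985Variational, (98) p.293, (119)-(120) p.295] -/
theorem quadAnalytic_curComm (ρ : (𝔸 →L[ℂ] ℂ) →L[ℂ] 𝔸) (τ : 𝔸 →L[ℂ] ℂ) (U₀ : Bond d Pd → 𝔸ˣ)
    (hUn : ∀ b, ‖(U₀ b : 𝔸)‖ ≤ 1 ∧ ‖(((U₀ b)⁻¹ : 𝔸ˣ) : 𝔸)‖ ≤ 1)
    (hτ : ∀ a b : 𝔸, τ (a * b) = τ (b * a)) (hL : 1 ≤ L) {Λ : ℝ} (hΛ1 : 1 ≤ Λ)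
    (hΛ : ∀ q ∈ posPlaq (TSite d Pd) (Fin d), ∀ (μ₀ : Fin d) (x₀ : TSite d Pd), q ∈ st Tsh μ₀ x₀ →
      levWeight L η lev₀ 1 (x₀, μ₀) ≤ Λ * plaqWeight Tsh (levWeight L η lev₀ 1) q)
    (hΛa : ∀ (x₀ : TSite d Pd) (μ₀ ν : Fin d) (y : TSite d Pd), (y = x₀ ∨ y = (Tsh ν).symm x₀) →
      levWeight L η lev₀ 1 (x₀, μ₀) ≤ Λ * levWeight L η lev₀ 1 (y, μ₀) ∧
        levWeight L η lev₀ 1 (x₀, μ₀) ≤ Λ * levWeight L η lev₀ 1 (y, ν))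
    (hΛ' : ∀ (x₀ : TSite d Pd) (μ₀ ν : Fin d) (y : TSite d Pd), (y = x₀ ∨ y = (Tsh ν).symm x₀) →
      ∀ κ κ'' : Fin d, (κ = μ₀ ∨ κ = ν) → (κ'' = μ₀ ∨ κ'' = ν) →
        levWeight L η lev₀ 1 (x₀, μ₀) ^ 2 ≤ Λ ^ 2 * levWeight L η lev₁ 2 ((y, κ), κ'')) (a₃ : ℝ) :
    B13Contraction113.QuadAnalytic (curComm (L := L) (η := η) (lev₀ := lev₀) (lev₁ := lev₁) (Dc := nabla115 η U₀) ρ τ U₀)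
      (((d - 1 : ℕ) : ℝ) * Λ ^ 3 * (136 + 2 * Λ) * ‖ρ‖ * ‖τ‖) a₃ :=
  (prop4Hyp_curComm (lev₁ := lev₁) ρ τ U₀ hUn hτ hL hΛ1 hΛ hΛa hΛ' a₃).quadAnalytic

end Bound

end Literature.MathematicalPhysics.QuantumFieldTheory.Balaban1983to89.B11Eq96CommutatorCurrent

end
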